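import Summits.HodgeConjecture.HodgeConjecture.Theorems.VHCAbelianSchemesRoadIsogenyDerivedAdjointPairOfRouteK
import Literature.Algebra.Homology.KInjectiveAdjunctionRepresentatives
import HarnessLib

/-!
# Road №4 (`VHCAbelianSchemesRoad`) — API of the route-K node `P₀ = isogenyDerivedAdjointPairOfRouteK`:
# independence of the chosen resolution, and `g_{**}` on representatives

research route conditional on HC_CM; not a corollary; Q11.4-sentence-2 already refuted in dim ≥ 3.

Seat core-w7 (route K; director-hodge g16 R16.20 (2), R16.21 (1): «(N3′) ⟸ route K naturality — ask them BY NAME for the Φ-vs-`mapShiftedHom`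
square»; core-w1 (TrPair) ask HOME INBOX l.5651). `--supports stmt-HodgeConjecture-26512 --as helper`; closes NO stub or item; nothing here
says (At)Pair, (Tr)Pair, (SC), T′, (c1), 26511 ∕ 26512 ∕ 23176, `HC_AV`, `HC_CM` or HC holds; HC_CM HELD, by name only; typed ≠ proved.

What the (At)∕(Tr) compatibilities and law (δ) consume about the node `P₀ A g hg := isogenyDerivedAdjointPairOfRouteK A g hg`
(`Theorems/VHCAbelianSchemesRoadIsogenyDerivedAdjointPairOfRouteK.lean`):

* **`isogenyDerivedAdjointPairOfRouteK_adj_eq_of_resolution`** — the hom-equivalence `adj hK hL n` may be computed with ANY route-K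
  resolution `r : RouteKResolution A g L` of the second variable (injective resolution `ι : L → I` with `g_*ι` a quasi-isomorphism), not just
  the chosen one: `adj hK hL n x = shiftedHomLinearEquivOfAdjunctionOfQuasiIso (pullbackPushforwardAdjunction g) K r.ι r.a r.quasiIso_pushforward n x`
  (resolution independence, `Literature/Algebra/Homology/KInjectiveAdjunctionRepresentatives`).
* `exists_representative_routeK` — every derived class `y : Q K ⟶ (Q L)⟦n⟧` has a chain-level representative `w̃ : K ⟶ I⟦n⟧` into any
  route-K resolution: `y ≫ (Q ι)⟦n⟧' = w̃.map Q` (K-injectivity).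
* **`mapShiftedHom_isogenyDerivedAdjointPairOfRouteK_eq`** — **`g_{**} y` IS `g_*` APPLIED TERMWISE TO A REPRESENTATIVE**: for such `w̃`,
  `(P₀ A g hg).mapShiftedHom hK hL y = (w̃.map g_*•).map Q ≫ (Q (g_*ι))⁻¹⟦n⟧'`.

References: [cite: Lipman2009, Prop. 3.2.3 and Cor. 3.2.4] [cite: Spaltenstein1988, Prop. 1.5] [cite: Weibel1994, §10.4]
[cite: Hartshorne1977, II §5 p. 110 (f^* ⊣ f_*) and III Prop. 8.1].
-/

noncomputable section

-- compositions through `(F ⋙ G).obj X = G.obj (F.obj X)` (as in Mathlib's `Shift/Adjunction.lean`)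
set_option backward.isDefEq.respectTransparency false

open CategoryTheory CategoryTheory.Category CategoryTheory.Limits AlgebraicGeometry
open DerivedCategory

namespace Summit.HodgeConjecture.HodgeConjecture.Ring2.SemiregularRepresentatives

set_option linter.dupNamespace false -- the cell's namespace repeats the summit name, as in every `Ring2*` file

open Literature.AlgebraicGeometry Literature.AlgebraicGeometry.Modules Literature.AlgebraicGeometry.Motives
open Literature.AlgebraicGeometry.Motives.AbelianVariety Literature.AlgebraicGeometry.KTheory Literature.Algebra.Homology

variable {A : AbelianVariety ℂ} {g : A ⟶ A} (hg : IsIsogeny g)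

/-- **The hom-equivalence of `P₀` may be computed with ANY route-K resolution of the second variable** (independence of the
chosen injective resolution: two resolutions are linked by a K-injective lift, along which the K-injective-model equivalences agree).
[cite: Lipman2009, Prop. 3.2.3 and Cor. 3.2.4] [cite: Spaltenstein1988, Prop. 1.5] -/
theorem isogenyDerivedAdjointPairOfRouteK_adj_eq_of_resolution {K L : CochainComplex A.X.left.Modules ℤ}
    (hK : IsBoundedVBComplex K) (hL : IsBoundedVBComplex L) (r : RouteKResolution A g L) (n : ℤ) :
    letI := HasDerivedCategory.standard A.X.left.Modules
    haveI := AbelianVariety.IsIsogeny.flat hg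
    haveI := preservesMonomorphisms_pullback_of_flat (Hom.toSchemeHom g)
    haveI : (Scheme.Modules.pushforward (Hom.toSchemeHom g)).Linear ℂ := linear_pushforward g.hom.hom.hom
    haveI := r.quasiIso
    haveI := r.injective
    haveI := r.isStrictlyGE
    (isogenyDerivedAdjointPairOfRouteK A g hg).adj hK hL n =
      shiftedHomLinearEquivOfAdjunctionOfQuasiIso (𝕜 := ℂ)
        (Scheme.Modules.pullbackPushforwardAdjunction (Hom.toSchemeHom g)) K r.ι r.a r.quasiIso_pushforward n := by
  letI := HasDerivedCategory.standard A.X.left.Modules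
  haveI := AbelianVariety.IsIsogeny.flat hg
  haveI := preservesMonomorphisms_pullback_of_flat (Hom.toSchemeHom g)
  haveI : (Scheme.Modules.pushforward (Hom.toSchemeHom g)).Linear ℂ := linear_pushforward g.hom.hom.hom
  haveI := (routeKResolution hg hL).quasiIso
  haveI := (routeKResolution hg hL).injective
  haveI := (routeKResolution hg hL).isStrictlyGE
  haveI := r.quasiIso
  haveI := r.injective
  haveI := r.isStrictlyGE
  rw [isogenyDerivedAdjointPairOfRouteK_adj]
  exact shiftedHomLinearEquivOfAdjunctionOfQuasiIso_eq_of_resolutions (𝕜 := ℂ) _ K _ _ _ _ _ _ n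

/-- **Representatives into a route-K resolution**: every derived class `y : Q K ⟶ (Q L)⟦n⟧` satisfies `y ≫ (Q ι)⟦n⟧' = w̃.map Q` for some
chain-level `w̃ : K ⟶ I⟦n⟧`, for any route-K resolution `ι : L → I` (K-injectivity of `I⟦n⟧`). [cite: Spaltenstein1988, Prop. 1.5] -/
theorem exists_representative_routeK {K L : CochainComplex A.X.left.Modules ℤ} (r : RouteKResolution A g L) (n : ℤ)
    (y : letI := HasDerivedCategory.standard A.X.left.Modules; ShiftedHom (Q.obj K) (Q.obj L) n) :
    letI := HasDerivedCategory.standard A.X.left.Modules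
    ∃ w : ShiftedHom K r.I n, (y ≫ (Q.map r.ι)⟦n⟧' : ShiftedHom (Q.obj K) (Q.obj r.I) n) = w.map Q := by
  letI := HasDerivedCategory.standard A.X.left.Modules
  haveI := r.injective
  haveI := r.isStrictlyGE
  obtain ⟨w, hw⟩ := exists_map_Q_eq K r.I r.a n (y ≫ (Q.map r.ι)⟦n⟧' : ShiftedHom (Q.obj K) (Q.obj r.I) n)
  exact ⟨w, hw.symm⟩

/-- **`g_{**} y` is `g_*` applied termwise to a representative of `y`**: for any route-K resolution `ι : L → I` and a chain-level
`w̃ : K ⟶ I⟦n⟧` with `y ≫ (Q ι)⟦n⟧' = w̃.map Q`,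
`(P₀ A g hg).mapShiftedHom hK hL y = (w̃.map g_*•).map Q ≫ (Q (g_*ι))⁻¹⟦n⟧'` — the form in which the (At)∕(Tr) compatibilities
(`AtiyahClassPushforwardCompatPair`, `TracePushforwardCompatPair`, (N3′)) meet the node. [cite: Lipman2009, Prop. 3.2.3]
[cite: Weibel1994, §10.4] [cite: Hartshorne1977, II §5 p. 110 (f^* ⊣ f_*)] -/
theorem mapShiftedHom_isogenyDerivedAdjointPairOfRouteK_eq {K L : CochainComplex A.X.left.Modules ℤ}
    (hK : IsBoundedVBComplex K) (hL : IsBoundedVBComplex L) (r : RouteKResolution A g L) {n : ℤ}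
    (y : letI := HasDerivedCategory.standard A.X.left.Modules; ShiftedHom (Q.obj K) (Q.obj L) n)
    (w : ShiftedHom K r.I n)
    (hw : letI := HasDerivedCategory.standard A.X.left.Modules;
      (y ≫ (Q.map r.ι)⟦n⟧' : ShiftedHom (Q.obj K) (Q.obj r.I) n) = w.map Q) :
    letI := HasDerivedCategory.standard A.X.left.Modules
    haveI := r.quasiIso
    haveI : IsIso (Q.map (((Scheme.Modules.pushforward (Hom.toSchemeHom g)).mapHomologicalComplex (ComplexShape.up ℤ)).map r.ι)) := by
      rw [DerivedCategory.isIso_Q_map_iff_quasiIso]; exact r.quasiIso_pushforward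
    (isogenyDerivedAdjointPairOfRouteK A g hg).mapShiftedHom hK hL y =
      (w.map ((Scheme.Modules.pushforward (Hom.toSchemeHom g)).mapHomologicalComplex (ComplexShape.up ℤ))).map Q ≫
        (inv (Q.map (((Scheme.Modules.pushforward (Hom.toSchemeHom g)).mapHomologicalComplex (ComplexShape.up ℤ)).map r.ι)))⟦n⟧' := by
  letI := HasDerivedCategory.standard A.X.left.Modules
  haveI := AbelianVariety.IsIsogeny.flat hg
  haveI := preservesMonomorphisms_pullback_of_flat (Hom.toSchemeHom g)
  haveI : (Scheme.Modules.pushforward (Hom.toSchemeHom g)).Linear ℂ := linear_pushforward g.hom.hom.hom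
  haveI := r.quasiIso
  haveI := r.injective
  haveI := r.isStrictlyGE
  rw [IsogenyDerivedAdjointPair.mapShiftedHom_def, isogenyDerivedAdjointPairOfRouteK_adj_eq_of_resolution hg _ hL r,
    counitClass_eq]
  exact shiftedHomLinearEquivOfAdjunctionOfQuasiIso_mk₀_counit_comp (𝕜 := ℂ)
    (Scheme.Modules.pullbackPushforwardAdjunction (Hom.toSchemeHom g)) K r.ι r.a r.quasiIso_pushforward n y w hw

end Summit.HodgeConjecture.HodgeConjecture.Ring2.SemiregularRepresentatives

end
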